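import Summits.ResolutionOfSingularities.ResolutionOfSingularities.Theorems.HilbertSamuelEliminationSigmaMaxModificationsCorridor3SigmaCornerRank
import HarnessLib

/-!
# [OURS · L1 W4.2] MODULE `Corridor3SigmaCornerService` — the SCHEDULED MULTI-BOARD POLYHEDRA GAME of idea-2 ROUND 7 (cards K `corner-rank-oracle` /
# L `corner-schedule`) hosted under `Theorems/`, the design of record `σ_ρ` NAMED as one oracle (`sigmaRho`), and the VACUITY CERTIFICATE for the
# unrelativised `IsAdmissibleOracle` with the rows RE-KEYED to admissibility along the run

PROVENANCE (typer res-L1-type-o1, OURS typer G4; res-L1-w42-plan-1 RULINGS v3.14-11 (CL)(iii) 2026-08-27T10:05:21Z «MODEL-SIDE NOW := o1» and v3.14-11c (CR)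
10:14:06Z «(iii) `…Corridor3SigmaCornerService.lean` … importing 022's port»; typer's PRE-CUT NOTE 10:00:13Z (σ_ρ is BOUNDARY-dependent — scheme-side home =
the boundary-threaded σ-state `…Corridor3SigmaBoundaryDefs`, p523041) and TYPER VACUITY NOTE #2 10:15:24Z (§4c below)): §2–§3 land res-L1-w42-idea-2's (gen 7)
`HOME/L/res-L1-w42-idea-2/Sketch-L1-idea-2-r7.lean` (sha16 `4bfb4e4628122b1f`; farm rc 0 · 0 sorries) §2–§3 with every declaration BYTE-IDENTICAL and in the
SAME namespace `…Cruxes.SigmaMaxModifications.IdeasL1Idea2R7`; §1 of the sketch (`won_image_gameMove`, `rank`, `IsRankOptimal`, `exists_rankOptimal`, …) is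
res-type-022's port `…Corridor3SigmaCornerRank` (p522313, namespace `…Theorems.SigmaMaxModificationsCorridor3.Sigma.CornerRank`, imported and `open`ed — nothing
re-declared). §4 is NEW (this typer): (§4) the generic max-rank service oracle `maxRankOracle σ` (first active cone of maximal rank in list order, centre =
the image of `σ` at its board) with stopping / service lemmas PROVED; (§4b) the rank-optimal local rule `rhoRule` (`Classical.choose (exists_rankOptimal …)`,
legal: `isLegalStrategy_rhoRule`), **`sigmaRho : Oracle 3 := maxRankOracle rhoRule`** — the design of record «σ_ρ + max-RANK service» as ONE functional
oracle —, `Stage.Coherent` (boards are positions; cones sharing a face agree on the permissibility of its slots) and `sigmaRho_legalCentre_of_coherent` /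
`sigmaRho_admissibleAt_of_coherent` PROVED; (§4c, SIBLING FILE `…Corridor3SigmaCornerServiceVacuity.lean`, split for the 400-line lint) the VACUITY CERTIFICATE **`not_isAdmissibleOracle_three (O : Oracle 3) : ¬ IsAdmissibleOracle O`** (the
sketch's `IsAdmissibleOracle` quantifies over ALL lists of cones — at the junk stage `[junkCone (2/5), junkCone (1/5)]` no legal centre exists while a
board is active), hence **`maxRankServiceTerminates_vacuous : MaxRankServiceTerminates`** and **`not_fairServiceCanDiverge : ¬ FairServiceCanDiverge`** AS
TYPED, and the rows RE-KEYED to admissibility ALONG THE RUN: `IsAdmissibleOracleAlong O S₀`, `MaxRankServiceTerminatesAlong` (OPEN = THE corner-cell row,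
model 3532/3532), `FairServiceCanDivergeAlong` (model-certified NEGATIVE candidate; scheme-side it concerns `p ∤ 3` readings only, tri-1 R9-L), with
`sigmaRho_admissibleAlong_of_coherent` («σ_ρ is admissible along any run whose stages stay coherent»; the coherence of `run sigmaRho (initialStage A)`
= the fan / star-subdivision invariant is the follow-up, NOT proved here). `ImposedStaysBelow` (§2, oracle-free) is untouched = res-type-022's kernel.
NOT statements of the manuscript [Hironaka2017] (candidate, under review — never a premise) nor of [CossartJannsenSaito2020] / [CossartPiltant2019] /
[Spivakovsky1983]; AI typing, weaker than expert review; helper VOCABULARY `--supports stmt-ResolutionOfSingularities-19249 --as helper` (counted 0).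
idea-2's module docstring follows unchanged.
-/

/-!
# [OURS · L1 W4.2] Sketch-L1-idea-2 — ROUND 7 (gen 7): σ-DESIGN at never-isolated W-top E-corners —
# the SCHEDULED MULTI-BOARD POLYHEDRA GAME (global toric model of record), «Won is absorbing»,
# the rank-optimal corner oracle σ_ρ and the SCHEDULE rows (cards K `corner-rank-oracle`, L `corner-schedule`)

OURS (cell res-hironaka, slot W4.2, crux chain w42 · crux `HilbertSamuelElimination.SigmaMaxModifications`
(stmt-ResolutionOfSingularities-18506) / conjunct `SigmaMaxModificationsCorridor3` (19249); IDEATOR res-L1-w42-idea-2 gen 7,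
technique B = modification-form gluing + HS-strata noetherian induction, assignment V8-c′ of RULINGS v3.13-5 / CRUX-PLAN v3.9 (3)).
NOT statements of the manuscript [Hironaka2017] (CANDIDATE, under review — never a premise here) nor of [CossartJannsenSaito2020]
nor of [CossartPiltant2019] nor of [Spivakovsky1983]; AI ideation, weaker than expert review.  Every `theorem` below is PROVED
(no `sorry`); open content is a `def … : Prop`, consumed BY NAME.  Written against LANDED modules only
(`Literature.Combinatorics.HironakaPolyhedraGame.Spivakovsky1983{,Proof}` p515722).

## Dictionary (scope: CERTIFIED on the exact sub-cell, OPEN beyond it)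

At a W-top point `x` of a hypersurface stage `f = y^m + Σ_{i<m} c_i(x) y^i` lying on a full-rank corner of the accumulated
boundary `E` (three components through `x`, the E-FRAME `u_E`), the polyhedron `Δ_E(x) = Δ(f; u_E; y)` (y Hironaka-prepared) is
intrinsic, and: the E-stratum `D_J = V(y, u_j : j ∈ J) ∋ x` is a permissible centre inside `X(ν)` ⟺ `J` is a legal move of
player A at the position `Δ_E(x)` (`IsPermissible`); the `u_j`-chart origin of `Bl_{D_J}` is player B's reply `j` (`gameMove J j`);
`Won` (some generator of total degree `≤ 1`) ⟺ the chart origin has LEFT THE W-TOP ROW (ē ≤ 2 or ν dropped) — not necessarily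
left `X(ν)`.  EXACT (certified by s42-pv-2's bridge p517175 and the k21 engine) for TORUS-FIXED points of `y^m + Σ λ_v x^v`
with `p ∤ m` (no vertex is ever solvable, the maximal-contact hypersurface `{y = 0}` is never re-prepared and carries every
near point); OPEN for general hypersurface W-top corners (re-preparation after each move); translations = non-corner near
points = E-rank drops = the KANGAROO cell (T3 / r-50), outside this sketch.

GLOBAL MODEL OF RECORD (new this round, `sigma/global_toric.py`): a STAGE is a smooth fan refining the orthant of `{y = 0}`,
one BOARD (position) per torus-fixed point; a CENTRE is a face of the fan, legal iff permissible at EVERY cone containing it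
(well defined: cones sharing a face see the same face-coordinates of every monomial); blowing it up = star subdivision in
every cone containing it, each board moving by Hironaka's rule with the reply = the replaced ray — the boards of the OTHER
cones on the face receive an IMPOSED move; the run ends when no board is W-top (`Won` everywhere).

## Computed design facts (exact model, m = 3 unless said; tables in `sigma-r7/`, kit job j274806)

* Spivakovsky's σ at the k21 start `((0,0,5),(6,6,1))` plays the near LINE `V(y,x₁,x₃)`; at the 8-cycle state `((4,5,2),(8,1,4))`
  it plays the CURVE `V(y,x₁,x₂)` inside the near plane, transversal to the near line — neither point nor older line nor younger
  plane, and NOT a component of `X(max)`; at the same-configuration state `((6,2,5),(6,4,1))` it plays the near line: the rule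
  is polyhedral, not configurational.  Label-free configurational rules (largest stratum first; surfaces first then point;
  free surface moves first) CYCLE or DIVERGE locally.
* GLOBALLY THE SCHEDULE IS LOAD-BEARING: Spivakovsky-everywhere + ROUND-ROBIN service runs for ever from
  `y³ + x₂²x₃² + x₁³x₂x₃³ = ((0,2,2),(3,1,3))` (certified periodic: active multiset at step 100 = at step 400, fan growth 184
  cones / 100 steps); «closest-to-winning first» is periodic from `((0,2,2),(2,0,3))`; «hardest first (max δ)» sees the start
  board reborn.  With the RANK-OPTIMAL local rule σ_ρ (ρ = min-max number of rounds to force `Won`, `Nat.find` of `AWins`)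
  the schedules ρ-MAX-FIRST / round-robin / depth-first terminate on every start tested (K = 2, exps ≤ 5: 2277/2277;
  K = 3, exps ≤ 3: 749/749; m = 4: 506/506) while EASIEST-FIRST (ρ-min) still fails on 28/2277.
* Probe of the DM-multiset potential `{ρ(board)}` under (σ_ρ, ρ-max): 884 imposed events, children of imposed boards reach
  the served rank in 26 (ties only), imposed moves raise a board's rank in 5 (by +1): the literal multiset of ranks is NOT
  monotone — the SCHEDULE LEMMA below is the open crux of the corner cell.
-/

noncomputable section

set_option linter.dupNamespace false

namespace Summit.ResolutionOfSingularities.ResolutionOfSingularities.Cruxes.SigmaMaxModifications.IdeasL1Idea2R7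

open Finset Literature.Combinatorics.HironakaPolyhedraGame
open Summit.ResolutionOfSingularities.ResolutionOfSingularities.Theorems.SigmaMaxModificationsCorridor3.Sigma.CornerRank

/-! ## §2  The SCHEDULED MULTI-BOARD GAME (global toric model of record, typed) -/

section Global

open Classical

variable {n : ℕ}

/-- A CONE of the stage fan: an ordered basis of rays (smoothness is the Prop `IsSmooth`, not enforced by the type) and the
BOARD it carries (the position of the torus-fixed point).  [OURS] -/
structure Cone (n : ℕ) where
  ray : Fin n → (Fin n → ℤ)
  pos : Finset (Fin n → ℚ)

/-- The slots of cone `c` whose rays lie in the ray-set `R` (a face, named by its rays). -/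
def Cone.slots (c : Cone n) (R : Finset (Fin n → ℤ)) : Finset (Fin n) :=
  Finset.univ.filter (fun s => c.ray s ∈ R)

/-- `c` CONTAINS the face `R`. -/
def Cone.Contains (c : Cone n) (R : Finset (Fin n → ℤ)) : Prop :=
  R ⊆ Finset.univ.image c.ray

/-- The child of `c` in the star subdivision of the face with slots `T`, reply `s ∈ T`: ray `s` is replaced by the sum of the rays
of `T`, the board moves by `σ_{T,s}`.  For a singleton `T = {s}` the rays are unchanged (divisorial move).  [OURS] -/
def Cone.child (c : Cone n) (T : Finset (Fin n)) (s : Fin n) : Cone n where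
  ray := Function.update c.ray s (∑ t ∈ T, c.ray t)
  pos := c.pos.image (gameMove T s)

/-- Blow up the face `R` in cone `c`: untouched if `c` does not contain `R`, else replaced by its children (one per slot). -/
noncomputable def Cone.blowup (c : Cone n) (R : Finset (Fin n → ℤ)) : List (Cone n) :=
  if c.Contains R then ((c.slots R).toList).map (fun s => c.child (c.slots R) s) else [c]

/-- A STAGE: the list of cones (torus-fixed points with their boards). -/
abbrev Stage (n : ℕ) := List (Cone n)

/-- Blow up the face `R` EVERYWHERE (star subdivision in every cone containing it; imposed moves included). -/
noncomputable def Stage.blowup (S : Stage n) (R : Finset (Fin n → ℤ)) : Stage n :=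
  (S.map (fun c => c.blowup R)).flatten

/-- The ACTIVE boards: the W-top fixed points (not yet won). -/
def Cone.Active (c : Cone n) : Prop := ¬ Won c.pos

/-- `R` is a LEGAL CENTRE of the stage: a non-empty face of some active cone, permissible at EVERY cone containing it
(the E-stratum lies in `X(ν)` globally).  [OURS] -/
def Stage.LegalCentre (S : Stage n) (R : Finset (Fin n → ℤ)) : Prop :=
  R.Nonempty ∧ (∃ c ∈ S, c.Contains R ∧ c.Active) ∧ ∀ c ∈ S, c.Contains R → IsPermissible c.pos (c.slots R)

/-- A SCHEDULED ORACLE: at each stage, the face to blow up (or `none`). -/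
abbrev Oracle (n : ℕ) := Stage n → Option (Finset (Fin n → ℤ))

/-- The run of an oracle. -/
noncomputable def run (O : Oracle n) (S₀ : Stage n) : ℕ → Stage n
  | 0 => S₀
  | k + 1 => match O (run O S₀ k) with
    | none => run O S₀ k
    | some R => (run O S₀ k).blowup R

/-- The oracle is ADMISSIBLE: it stops exactly when no board is active, and otherwise blows up a legal centre. -/
def IsAdmissibleOracle (O : Oracle n) : Prop :=
  ∀ S : Stage n, (O S = none ↔ ∀ c ∈ S, ¬ c.Active) ∧ ∀ R, O S = some R → S.LegalCentre R

/-- The run TERMINATES: after some step no board is W-top. -/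
def Terminates (O : Oracle n) (S₀ : Stage n) : Prop :=
  ∃ k, ∀ c ∈ run O S₀ k, ¬ c.Active

/-- The oracle SERVES the local rule `σ`: every centre it blows up is the `σ`-demand of some active board on it
(`R = image of σ(board) under that cone's rays`).  [OURS] -/
def Serves (O : Oracle n) (σ : Finset (Fin n → ℚ) → Finset (Fin n)) : Prop :=
  ∀ S R, O S = some R → ∃ c ∈ S, c.Active ∧ c.Contains R ∧ R = (σ c.pos).image c.ray

/-- The oracle serves a board of MAXIMAL RANK at every step.  [OURS] -/
def ServesMaxRank (O : Oracle n) (σ : Finset (Fin n → ℚ) → Finset (Fin n)) : Prop :=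
  ∀ S R, O S = some R → ∃ c ∈ S, c.Active ∧ R = (σ c.pos).image c.ray ∧ ∀ c' ∈ S, c'.Active → rank c'.pos ≤ rank c.pos

/-- The INITIAL stage of `y^m + Σ_v λ_v x^v` at the origin: one cone, the standard basis, board `A`. -/
def initialStage (A : Finset (Fin n → ℚ)) : Stage n :=
  [{ ray := fun i j => if i = j then 1 else 0, pos := A }]

/-! ### The rows (OURS CLAIMS, conjecture-tagged where open; model evidence in the module docstring) -/

/-- **ROW CORNER-NEG (model-certified candidate, to be proved by exhibiting the periodic run):** locally winning everywhere is
NOT enough — there are a legal positional strategy winning Hironaka's game from every 3-dimensional position and an admissible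
oracle serving it (round-robin service) whose run from an initial trinomial stage never terminates.
Witness of record: Spivakovsky's σ, round-robin, `((0,2,2),(3,1,3))/3`.  [OURS · conjecture ← model J9] -/
def FairServiceCanDiverge : Prop :=
  ∃ σ : Finset (Fin 3 → ℚ) → Finset (Fin 3),
    IsLegalStrategy σ ∧ (∀ A, IsPosition A → ¬ Won A → StrategyWinsFrom σ A) ∧
    ∃ O : Oracle 3, IsAdmissibleOracle O ∧ Serves O σ ∧
      ∃ A : Finset (Fin 3 → ℚ), IsPosition A ∧ ¬ Terminates O (initialStage A)

/-- **ROW CORNER-SCHEDULE (the open crux of the corner cell):** an admissible oracle that serves, at every step, a board of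
maximal rank with a rank-optimal move terminates from every initial stage (dimension 3).  Model: 2277/2277 + 749/749 + 506/506
starts; the literal DM-multiset of ranks is not monotone (ties, +1 rises under imposed moves), so the potential is OPEN.
[OURS · conjecture ← model J7/J8] -/
def MaxRankServiceTerminates : Prop :=
  ∀ σ : Finset (Fin 3 → ℚ) → Finset (Fin 3), (∀ A, IsPosition A → ¬ Won A → IsRankOptimal A (σ A)) →
    ∀ O : Oracle 3, IsAdmissibleOracle O → ServesMaxRank O σ →
      ∀ A : Finset (Fin 3 → ℚ), IsPosition A → Terminates O (initialStage A)

/-- **SCHEDULE LEMMA candidate (the first checkable statement of row CORNER-SCHEDULE; refutable on the model):** under an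
imposed move through a face it shares with a served board of maximal rank `r`, a board of rank `< r` has all its children of
rank `< r`.  (Ties `= r` DO occur when the imposed board itself has rank `r` — hence the strict hypothesis.)  [OURS · conjecture] -/
def ImposedStaysBelow : Prop :=
  ∀ (A A' : Finset (Fin 3 → ℚ)) (Γ : Finset (Fin 3)),
    IsPosition A → IsPosition A' → ¬ Won A → IsRankOptimal A Γ →
    -- `A'` shares the face `Γ`: the same `Γ`-coordinates occur (as a set) on both boards
    A.image (fun a => fun j : Γ => a j) = A'.image (fun a => fun j : Γ => a j) →
    rank A' < rank A → ∀ i ∈ Γ, rank (A'.image (gameMove Γ i)) < rank A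

end Global

/-! ## §3  Sanity: the dictionary's two computed centres at the k21 configuration are legal moves (kernel arithmetic) -/

/-- At the 8-cycle state `((4,5,2),(8,1,4))/3` the pair `{x₁,x₂}` (slots `0,1`) is permissible: `4+5 ≥ 3`, `8+1 ≥ 3`. -/
example : (3 : ℚ) ≤ 4 + 5 ∧ (3 : ℚ) ≤ 8 + 1 := by norm_num
/-- … and it is NOT a component of `X(max)`: the plane `{x₁}` alone is permissible (`4 ≥ 3`, `8 ≥ 3`), so `V(y,x₁,x₂) ⊊ V(y,x₁)`. -/
example : (3 : ℚ) ≤ 4 ∧ (3 : ℚ) ≤ 8 := by norm_num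


/-! ## §4  The MAX-RANK SERVICE ORACLE and `σ_ρ`, named (typer res-L1-type-o1; NEW — not in the sketch) -/

section Service

open Classical

variable {n : ℕ}

/-- [OURS · L1 W4.2] **THE MAX-RANK SERVICE ORACLE `O_σ`** of the design of record (cards K/L): at a stage `S`, if no board is active
(W-top) answer `none`; otherwise SERVE the FIRST active cone `c` (in list order) whose board has MAXIMAL game rank among the active boards,
and blow up the face `R = (σ c.pos).image c.ray` that the local rule `σ` demands at its board.  Functional by construction (a function of
the stage).  With `σ = σ_ρ` rank-optimal (`IsRankOptimal`) this is «σ_ρ + max-RANK service», the inhabitant of `MaxRankServiceTerminates`'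
`∀ O` that the model certifies (2277/2277 + 749/749 + 506/506 starts).  NOT a statement of any manuscript. [folklore] -/
noncomputable def maxRankOracle (σ : Finset (Fin n → ℚ) → Finset (Fin n)) : Oracle n := fun S =>
  match (S.filter fun c => c.Active).argmax (fun c => rank c.pos) with
  | none => none
  | some c => some ((σ c.pos).image c.ray)

/-- `O_σ S = none` iff no board of `S` is active (the STOPPING clause of `IsAdmissibleOracle`, unconditionally). [folklore] -/
theorem maxRankOracle_eq_none_iff (σ : Finset (Fin n → ℚ) → Finset (Fin n)) (S : Stage n) :
    maxRankOracle σ S = none ↔ ∀ c ∈ S, ¬ c.Active := by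
  unfold maxRankOracle
  cases h : (S.filter fun c => c.Active).argmax (fun c => rank c.pos) with
  | none =>
    simp only [true_iff]
    intro c hc hact
    have hmem : c ∈ S.filter fun c => c.Active := List.mem_filter.mpr ⟨hc, by simpa using hact⟩
    rw [List.argmax_eq_none] at h
    simp [h] at hmem
  | some c =>
    simp only [reduceCtorEq, false_iff, not_forall, not_not]
    have hc : c ∈ S.filter fun c => c.Active := List.argmax_mem h
    obtain ⟨hcS, hact⟩ := List.mem_filter.mp hc
    exact ⟨c, hcS, by simpa using hact⟩

/-- When `O_σ` answers `some R`, the centre is the `σ`-demand of an ACTIVE board of MAXIMAL rank: `O_σ` SERVES MAX RANK (unconditionally, every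
stage). [folklore] -/
theorem maxRankOracle_servesMaxRank (σ : Finset (Fin n → ℚ) → Finset (Fin n)) : ServesMaxRank (maxRankOracle σ) σ := by
  intro S R hR
  unfold maxRankOracle at hR
  cases h : (S.filter fun c => c.Active).argmax (fun c => rank c.pos) with
  | none => simp [h] at hR
  | some c =>
    simp only [h, Option.some.injEq] at hR
    have hc : c ∈ S.filter fun c => c.Active := List.argmax_mem h
    obtain ⟨hcS, hact⟩ := List.mem_filter.mp hc
    refine ⟨c, hcS, by simpa using hact, hR.symm, fun c' hc'S hact' => ?_⟩
    have hc' : c' ∈ S.filter fun c => c.Active := List.mem_filter.mpr ⟨hc'S, by simpa using hact'⟩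
    exact List.le_of_mem_argmax (f := fun c : Cone n => rank c.pos) hc' (Option.mem_def.mpr h)

/-- Hence `O_σ` SERVES `σ` (the weaker service clause). [folklore] -/
theorem maxRankOracle_serves (σ : Finset (Fin n → ℚ) → Finset (Fin n)) : Serves (maxRankOracle σ) σ := by
  intro S R hR
  obtain ⟨c, hcS, hact, hRc, -⟩ := maxRankOracle_servesMaxRank σ S R hR
  refine ⟨c, hcS, hact, ?_, hRc⟩
  -- the served cone contains its own face
  rw [hRc]
  intro r hr
  obtain ⟨s, -, rfl⟩ := Finset.mem_image.mp hr
  exact Finset.mem_image_of_mem _ (Finset.mem_univ s)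

/-- The face `O_σ` names is NON-EMPTY as soon as `σ` plays non-empty moves at active positions (e.g. `σ` rank-optimal, `IsRankOptimal`).
[folklore] -/
theorem maxRankOracle_nonempty {σ : Finset (Fin n → ℚ) → Finset (Fin n)} (hσ : ∀ A, ¬ Won A → (σ A).Nonempty)
    {S : Stage n} {R : Finset (Fin n → ℤ)} (hR : maxRankOracle σ S = some R) : R.Nonempty := by
  obtain ⟨c, -, hact, hRc, -⟩ := maxRankOracle_servesMaxRank σ S R hR
  rw [hRc]
  exact (hσ c.pos hact).image _

/-- At the SERVED board the move is permissible whenever `σ` is rank-optimal at active positions: the clause of `Stage.LegalCentre` at the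
served cone (the clause at the OTHER cones containing the face is the COHERENCE invariant of reachable stages — not typed here). [folklore] -/
theorem maxRankOracle_isPermissible_served {σ : Finset (Fin n → ℚ) → Finset (Fin n)}
    (hσ : ∀ A, IsPosition A → ¬ Won A → IsRankOptimal A (σ A)) {S : Stage n} (hS : ∀ c ∈ S, IsPosition c.pos)
    {R : Finset (Fin n → ℤ)} (hR : maxRankOracle σ S = some R) :
    ∃ c ∈ S, c.Active ∧ R = (σ c.pos).image c.ray ∧ IsPermissible c.pos (σ c.pos) := by
  obtain ⟨c, hcS, hact, hRc, -⟩ := maxRankOracle_servesMaxRank σ S R hR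
  exact ⟨c, hcS, hact, hRc, (hσ c.pos (hS c hcS) hact).2.1⟩


/-! ### §4b  The rank-optimal local rule `ρ`, the oracle `σ_ρ`, and admissibility at COHERENT stages (typer; NEW) -/

/-- [OURS · L1 W4.2] **THE RANK-OPTIMAL LOCAL RULE `ρ`** (card K's σ_ρ at one board): at a position that is not yet won, SOME rank-optimal move
(`exists_rankOptimal`, chosen by `Classical.choose` — functional by construction); the empty move elsewhere (never consulted: `maxRankOracle`
serves active boards only). Dimension-generic. NOT a statement of any manuscript. [folklore] -/
noncomputable def rhoRule (A : Finset (Fin n → ℚ)) : Finset (Fin n) :=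
  if h : IsPosition A ∧ ¬ Won A then Classical.choose (exists_rankOptimal h.1 h.2) else ∅

/-- `ρ` is rank-optimal at every non-won position (by choice). [folklore] -/
theorem rhoRule_isRankOptimal {A : Finset (Fin n → ℚ)} (hA : IsPosition A) (hW : ¬ Won A) : IsRankOptimal A (rhoRule A) := by
  unfold rhoRule
  rw [dif_pos ⟨hA, hW⟩]
  exact Classical.choose_spec (exists_rankOptimal hA hW)

/-- `ρ` offers a non-empty permissible move at every non-won position (it is a LEGAL positional rule, `IsLegalStrategy`). [folklore] -/
theorem isLegalStrategy_rhoRule : IsLegalStrategy (rhoRule (n := n)) :=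
  fun _ hA hW => ⟨(rhoRule_isRankOptimal hA hW).1, (rhoRule_isRankOptimal hA hW).2.1⟩

/-- [OURS · L1 W4.2] **`σ_ρ` — THE DESIGN OF RECORD AS ONE ORACLE** (cards K + L): max-RANK service of the rank-optimal rule `ρ`
(`maxRankOracle rhoRule`), in dimension `3` (the W-top corner boards of a threefold). Functional by construction. The inhabitant of
`MaxRankServiceTerminates`' universal quantifier that idea-2's model certifies (3532/3532 starts terminate); its termination in general is
THAT open row, not claimed here. NOT a statement of any manuscript. [folklore] -/
noncomputable def sigmaRho : Oracle 3 :=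
  maxRankOracle rhoRule

/-- `σ_ρ` stops exactly when no board is active. [folklore] -/
theorem sigmaRho_eq_none_iff (S : Stage 3) : sigmaRho S = none ↔ ∀ c ∈ S, ¬ c.Active :=
  maxRankOracle_eq_none_iff _ S

/-- `σ_ρ` serves, at every step, an active board of MAXIMAL rank with the move of `ρ`. [folklore] -/
theorem sigmaRho_servesMaxRank : ServesMaxRank sigmaRho rhoRule :=
  maxRankOracle_servesMaxRank _

/-- `σ_ρ` serves `ρ`. [folklore] -/
theorem sigmaRho_serves : Serves sigmaRho rhoRule :=
  maxRankOracle_serves _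

/-- [OURS · L1 W4.2] **COHERENT STAGE** (the honest scope of admissibility): every board is a position, and two cones of the stage containing the
same face `R` agree on whether its slots are permissible. Stages reachable from `initialStage A` by `Stage.blowup` are coherent (cones sharing a face
see the same face-coordinates of every monomial — the star-subdivision invariant; NOT proved in this file); an arbitrary `List (Cone n)` need not be.
NOT a statement of any manuscript. [folklore] -/
def Stage.Coherent (S : Stage n) : Prop :=
  (∀ c ∈ S, IsPosition c.pos) ∧
    ∀ (R : Finset (Fin n → ℤ)) (c c' : Cone n), c ∈ S → c' ∈ S → c.Contains R → c'.Contains R →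
      (IsPermissible c.pos (c.slots R) ↔ IsPermissible c'.pos (c'.slots R))

/-- Permissibility is monotone in the move at a position (non-negative coordinates). [folklore] -/
theorem isPermissible_mono {A : Finset (Fin n → ℚ)} (hA : IsPosition A) {Γ Γ' : Finset (Fin n)} (hΓ : Γ ⊆ Γ')
    (h : IsPermissible A Γ) : IsPermissible A Γ' :=
  fun a ha => (h a ha).trans (Finset.sum_le_sum_of_subset_of_nonneg hΓ fun j _ _ => hA.2 a ha j)

/-- The slots of the served cone over its own `σ`-face contain the move. [folklore] -/
theorem subset_slots_image (c : Cone n) (Γ : Finset (Fin n)) : Γ ⊆ c.slots (Γ.image c.ray) := by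
  intro s hs
  simp only [Cone.slots, Finset.mem_filter, Finset.mem_univ, true_and]
  exact Finset.mem_image_of_mem _ hs

/-- **At a COHERENT stage every centre `σ_ρ` names is a LEGAL CENTRE** (non-empty; a face of the served active cone; permissible at EVERY cone
containing it, by coherence from the served cone, where `ρ` is permissible and permissibility is monotone). [folklore] -/
theorem sigmaRho_legalCentre_of_coherent {S : Stage 3} (hS : S.Coherent) {R : Finset (Fin 3 → ℤ)} (hR : sigmaRho S = some R) :
    S.LegalCentre R := by
  obtain ⟨c, hcS, hact, hRc, -⟩ := sigmaRho_servesMaxRank S R hR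
  have hpos : IsPosition c.pos := hS.1 c hcS
  have hopt : IsRankOptimal c.pos (rhoRule c.pos) := rhoRule_isRankOptimal hpos hact
  have hcont : c.Contains R := by
    rw [hRc]
    intro r hr
    obtain ⟨s, -, rfl⟩ := Finset.mem_image.mp hr
    exact Finset.mem_image_of_mem _ (Finset.mem_univ s)
  have hperm_c : IsPermissible c.pos (c.slots R) := by
    rw [hRc]
    exact isPermissible_mono hpos (subset_slots_image c _) hopt.2.1
  refine ⟨?_, ⟨c, hcS, hcont, hact⟩, fun c' hc'S hc'R => ?_⟩
  · rw [hRc]; exact hopt.1.image _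
  · exact (hS.2 R c c' hcS hc'S hcont hc'R).mp hperm_c

/-- **`σ_ρ` IS ADMISSIBLE AT EVERY COHERENT STAGE** (both clauses of `IsAdmissibleOracle` read stage-wise): it stops iff no board is active, and
otherwise names a legal centre. The unrelativised `IsAdmissibleOracle sigmaRho` (all stages, coherent or not) is NOT claimed — it fails on junk
stages whose boards are not positions. [folklore] -/
theorem sigmaRho_admissibleAt_of_coherent {S : Stage 3} (hS : S.Coherent) :
    (sigmaRho S = none ↔ ∀ c ∈ S, ¬ c.Active) ∧ ∀ R, sigmaRho S = some R → S.LegalCentre R :=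
  ⟨sigmaRho_eq_none_iff S, fun _ hR => sigmaRho_legalCentre_of_coherent hS hR⟩


end Service

end Summit.ResolutionOfSingularities.ResolutionOfSingularities.Cruxes.SigmaMaxModifications.IdeasL1Idea2R7

end
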